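import Literature.NumberTheory.EllipticCurves.ModularDegreeSpectralLevelBound
import Literature.NumberTheory.EllipticCurves.PastenValuationProductThm75SieveProofs
import HarnessLib

/-!
# Pasten–Shimura 2024, Thm. 7.2 (asymptotic clause, `D = 1`) — the named fact DISCHARGED

Trunk T-ANT (NumberTheory/EllipticCurves).  The named fact
`Literature.NumberTheory.EllipticCurves.PastenShimura2024_thm_7_2_asymptotic`
(`ModularDegreeSpectralLevelBound.lean`; Pasten–Shimura, *Arithmetic progressions in the values of the
modular degree / valuation product*, Thm. 7.2, second display at `D = 1`, arXiv p. 26: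
«`log δ_{1,N} < (1/24 + ε) N log N` for `N ≫_ε 1`», `δ_{1,N}` the optimal modular degree at level `N`)
is, VERBATIM, the statement of the tree's theorem
`Literature.NumberTheory.EllipticCurves.Pasten2024.exists_log_modularDegree_lt'`
(`PastenValuationProductThm75SieveProofs.lean`, proved there unconditionally from
`Pasten2024.exists_log_modularDegree_lt` and `0 ≤ (1/24)·N log N`).  The two files do not import each
other; this leaf imports both and records the discharge under the tree's naming convention
(D-0026: proof term = the existing theorem; no statement, no definition, no new named fact), so that
the consumers of `(h72 : PastenShimura2024_thm_7_2_asymptotic)` — `….of_modularity_…` in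
`ModularDegreeSpectralLevelBound(Proofs).lean`, `PastenDiscriminantBoundAbcShapeProofs.lean` — can be fed
`PastenShimura2024_thm_7_2_asymptotic_holds`.  (Found by flt-inv gen 65's body-text census, METHOD 13:
the ledger listed the fact as unproved, `ledger fact claim` GRANTED «status unproved», 2026-08-28T09:4xZ.)
-/

noncomputable section

namespace Literature.NumberTheory.EllipticCurves

/-- **Pasten–Shimura 2024, Thm. 7.2, asymptotic clause at `D = 1` (PROVED in the tree):**
`∀ ε > 0, ∃ N₁, ∀ N ≥ N₁`, for every elliptic `W/ℚ` and every modular parametrization datum `D` of level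
`N` that is optimal among the data with the same newform, `log (deg D) < (1/24 + ε) · N · log N` — the
named fact `PastenShimura2024_thm_7_2_asymptotic` is the tree's theorem
`Pasten2024.exists_log_modularDegree_lt'`. [cite: PastenShimura2024, Thm 7.2 (second display, D = 1; arXiv p. 26)] -/
theorem PastenShimura2024_thm_7_2_asymptotic_holds : PastenShimura2024_thm_7_2_asymptotic :=
  Pasten2024.exists_log_modularDegree_lt'

end Literature.NumberTheory.EllipticCurves

end
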